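import Literature.NumberTheory.Automorphic.ArchKirillovBoundGL2
import Literature.NumberTheory.Automorphic.ArchKirillovNullSpaceGL2
import Literature.NumberTheory.Automorphic.MixedSpaceUnitsMellinProduct
import Mathlib.Analysis.SpecialFunctions.JapaneseBracket
import HarnessLib

/-!
# Absolute convergence of the archimedean Hecke integrals `∫ W_v(diag(u,1)) N(u)^{s-1/2} d^×u`
# of ALL Gårding vectors (Jacquet–Langlands (1970), Thm. 5.15 (i), Thm. 6.4 (i))

Topic `NumberTheory/Automorphic`; namespace `Literature.NumberTheory.Automorphic`. Theorems only (no
definition, no named fact, no instance). Let `τ` be an irreducible unitary strongly continuous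
representation of `G_∞ = GL₂(K_∞)` (`K_∞ = mixedSpace K`) on a Hilbert space `E`, `ℓ` a continuous
`ψ_∞`-Whittaker functional on its Gårding space `𝒢` and `W_v(u) = ℓ(τ(diag(u,1)) v)` (`kirillovFn`) the
Kirillov function of `v ∈ 𝒢`. Jacquet–Langlands (1970), Thm. 5.15 (i) (`GL₂(ℝ)`) and Thm. 6.4 (i)
(`GL₂(ℂ)`) state that the local Hecke integrals `Ψ(g, s, W) = ∫ W(diag(a,1) g) |a|^{s-1/2} d^×a` of the
(`K`-finite) Whittaker functions CONVERGE ABSOLUTELY IN SOME RIGHT HALF-PLANE. This file proves it, for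
every Gårding vector of a unitary `τ` and every Haar measure `μ` of `K_∞ˣ`, on the half-plane `re s ≥ 1`:

* `integrable_kirillovFn_mul_norm_cpow` — **`u ↦ W_v(u) N(u)^{s-1/2}` is `μ`-integrable on `K_∞ˣ` for
  `re s ≥ 1`**, for every `v ∈ 𝒢`.

Proof (soft, classification-free). (1) By the infinitesimal Whittaker covariance
`W_{τ(E₀₁ ⊗ x) v}(u) = dψ_∞(E₀₁ ⊗ ux) W_v(u)` (`apply_gardingAct_diagGL2_gardingEnd_single_zero_one`,
Jacquet–Langlands' Lemma 5.13.1) with `dψ_∞(E₀₁ ⊗ u r_w) = -2πi u_w` at a real place and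
`dψ_∞(E₀₁ ⊗ u c_w) = -4πi Re z_w`, `dψ_∞(E₀₁ ⊗ u ic_w) = 4πi Im z_w` at a complex one, the weights
`Φ_m(u) = ∏_{w real} (1 + u_w²)^m ∏_{w complex} (1 + |z_w|²)^m` are Kirillov multipliers:
`Φ_m W_v = W_{v'}` for the Gårding vector `v' = ∏_w (1 - (4π²)⁻¹ τ(E₀₁ ⊗ r_w)²)^m ⋯ v`
(`exists_kirillovFn_eq_weight_mul`). (2) By Jacquet–Shalika's bound `W_{v'} ∈ L²(K_∞ˣ, μ)`
(`memLp_kirillovFn`, `ArchKirillovBoundGL2`). (3) The weight `Φ_m(u)⁻¹ N(u)^{σ-1/2}` is in `L²(μ)` for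
`1 ≤ σ ≤ m` (`d^×u = c dx/N(x)` and Fubini, `integrable_and_integral_units_prod_mul_norm_cpow`; the
one-variable majorants are Japanese brackets `(1 + t²)^{-r/2}`, Mathlib `integrable_rpow_neg_one_add_norm_sq`),
and Cauchy–Schwarz: `|W_v N^{s-1/2}| = |Φ_m W_v| · Φ_m⁻¹ N^{σ-1/2}`.

This discharges the two `Integrable` clauses of the Kirillov-only archimedean input of
`HeckeEulerFactorisationGL2DualKirillov` (`…_of_archHeckeTestVectorMinW`).

## References

* H. Jacquet, R. P. Langlands, *Automorphic Forms on GL(2)*, LNM 114 (1970), §5 Thm. 5.15 (i) (p. 190 of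
  the original edition / Lemma 5.13.1), §6 Thm. 6.4 (i). [JacquetLanglands1970]
* H. Jacquet, J. A. Shalika, *On Euler products and the classification of automorphic representations I*,
  Amer. J. Math. 103 (1981), §3, (3.16). [JacquetShalikaAJM1981]
-/

noncomputable section

open MeasureTheory Measure NumberField NumberField.InfinitePlace NumberField.mixedEmbedding Set Filter Complex
open scoped MatrixGroups ENNReal NNReal Topology Classical

namespace Literature.NumberTheory.Automorphic

variable {K : Type} [Field K] [NumberField K]

-- as in `ArchGardingWhittaker`
set_option backward.isDefEq.respectTransparency false

/-! ### 1. Polynomial weights are Kirillov multipliers -/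

section Multipliers

variable {hcpt : isCompact_glFiniteIntegralLevel 2 K}
  {E : Type*} [NormedAddCommGroup E] [NormedSpace ℂ E] [CompleteSpace E]
  {τ : ContRepresentation ℂ (AutomorphyDatum.gl 2 K hcpt).arch.carrier E}
  (hτ : τ.IsStronglyContinuous) {ℓ : archGardingSpace hcpt τ →ₗ[ℂ] ℂ}

/-- `W_{v - c x}(u) = W_v(u) - c W_x(u)`. [folklore] -/
theorem kirillovFn_sub_smul (ℓ : archGardingSpace hcpt τ →ₗ[ℂ] ℂ) (c : ℂ) (v x : archGardingSpace hcpt τ)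
    (u : (mixedSpace K)ˣ) :
    kirillovFn hτ ℓ (v - c • x) u = kirillovFn hτ ℓ v u - c * kirillovFn hτ ℓ x u := by
  rw [kirillovFn_eq_apply_gardingAct, kirillovFn_eq_apply_gardingAct, kirillovFn_eq_apply_gardingAct, map_sub,
    map_smul, map_sub, map_smul, smul_eq_mul]

/-- **Real letters**: `W_{τ(E₀₁ ⊗ r_w) v}(u) = -2πi u_w W_v(u)`. [cite: JacquetLanglands1970, §5 (Lemma 5.13.1)] -/
theorem kirillovFn_gardingEnd_realIdem (hℓW : IsArchContWhittakerFunctional hcpt τ hτ ℓ)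
    (w : {w : InfinitePlace K // IsReal w}) (v : archGardingSpace hcpt τ) (u : (mixedSpace K)ˣ) :
    kirillovFn hτ ℓ (gardingEnd hτ (Matrix.single 0 1 ((Pi.single w 1, 0) : mixedSpace K)) v) u =
      ((-(2 * Real.pi) * (u : mixedSpace K).1 w : ℝ) : ℂ) * I * kirillovFn hτ ℓ v u := by
  rw [kirillovFn_eq_apply_gardingAct, kirillovFn_eq_apply_gardingAct,
    apply_gardingAct_diagGL2_gardingEnd_single_zero_one hτ hℓW, (archWhittakerDChar_mul_realIdem u w).1]

/-- **Complex letters**: `W_{τ(E₀₁ ⊗ c_w) v}(u) = -4πi (Re z_w) W_v(u)`. [cite: JacquetLanglands1970, §6] -/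
theorem kirillovFn_gardingEnd_complexIdem (hℓW : IsArchContWhittakerFunctional hcpt τ hτ ℓ)
    (w : {w : InfinitePlace K // IsComplex w}) (v : archGardingSpace hcpt τ) (u : (mixedSpace K)ˣ) :
    kirillovFn hτ ℓ (gardingEnd hτ (Matrix.single 0 1 ((0, Pi.single w 1) : mixedSpace K)) v) u =
      ((-(2 * Real.pi) * (2 * ((u : mixedSpace K).2 w).re) : ℝ) : ℂ) * I * kirillovFn hτ ℓ v u := by
  rw [kirillovFn_eq_apply_gardingAct, kirillovFn_eq_apply_gardingAct,
    apply_gardingAct_diagGL2_gardingEnd_single_zero_one hτ hℓW, archWhittakerDChar, if_pos (by decide),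
    mixedTrace_mul_complexIdem]

/-- **Complex letters**: `W_{τ(E₀₁ ⊗ ic_w) v}(u) = 4πi (Im z_w) W_v(u)`. [cite: JacquetLanglands1970, §6] -/
theorem kirillovFn_gardingEnd_complexIdemI (hℓW : IsArchContWhittakerFunctional hcpt τ hτ ℓ)
    (w : {w : InfinitePlace K // IsComplex w}) (v : archGardingSpace hcpt τ) (u : (mixedSpace K)ˣ) :
    kirillovFn hτ ℓ (gardingEnd hτ (Matrix.single 0 1 ((0, Pi.single w Complex.I) : mixedSpace K)) v) u =
      ((-(2 * Real.pi) * (-2 * ((u : mixedSpace K).2 w).im) : ℝ) : ℂ) * I * kirillovFn hτ ℓ v u := by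
  rw [kirillovFn_eq_apply_gardingAct, kirillovFn_eq_apply_gardingAct,
    apply_gardingAct_diagGL2_gardingEnd_single_zero_one hτ hℓW, archWhittakerDChar, if_pos (by decide),
    mixedTrace_mul_complexIdemI]

/-- **`1 + u_w²` is a Kirillov multiplier** at a real place:
`(1 + u_w²) W_v = W_{v'}`, `v' = v - (4π²)⁻¹ τ(E₀₁ ⊗ r_w)² v`. [cite: JacquetLanglands1970, §5 (Lemma 5.13.1)] -/
theorem exists_kirillovFn_eq_one_add_sq_real_mul (hℓW : IsArchContWhittakerFunctional hcpt τ hτ ℓ)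
    (w : {w : InfinitePlace K // IsReal w}) (v : archGardingSpace hcpt τ) :
    ∃ v' : archGardingSpace hcpt τ, ∀ u : (mixedSpace K)ˣ,
      kirillovFn hτ ℓ v' u = ((1 + ((u : mixedSpace K).1 w) ^ 2 : ℝ) : ℂ) * kirillovFn hτ ℓ v u := by
  refine ⟨v - (((4 * Real.pi ^ 2)⁻¹ : ℝ) : ℂ) •
    gardingEnd hτ (Matrix.single 0 1 ((Pi.single w 1, 0) : mixedSpace K))
      (gardingEnd hτ (Matrix.single 0 1 ((Pi.single w 1, 0) : mixedSpace K)) v), fun u => ?_⟩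
  rw [kirillovFn_sub_smul, kirillovFn_gardingEnd_realIdem hτ hℓW, kirillovFn_gardingEnd_realIdem hτ hℓW]
  have hπ : (Real.pi : ℂ) ≠ 0 := by exact_mod_cast Real.pi_ne_zero
  push_cast
  field_simp
  linear_combination (-4) * ((u : mixedSpace K).1 w : ℂ) ^ 2 * kirillovFn hτ ℓ v u * Complex.I_sq

/-- **`1 + |z_w|²` is a Kirillov multiplier** at a complex place:
`(1 + |z_w|²) W_v = W_{v'}`, `v' = v - (16π²)⁻¹ (τ(E₀₁ ⊗ c_w)² + τ(E₀₁ ⊗ ic_w)²) v`. [cite: JacquetLanglands1970, §6] -/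
theorem exists_kirillovFn_eq_one_add_normSq_complex_mul (hℓW : IsArchContWhittakerFunctional hcpt τ hτ ℓ)
    (w : {w : InfinitePlace K // IsComplex w}) (v : archGardingSpace hcpt τ) :
    ∃ v' : archGardingSpace hcpt τ, ∀ u : (mixedSpace K)ˣ,
      kirillovFn hτ ℓ v' u = ((1 + ‖(u : mixedSpace K).2 w‖ ^ 2 : ℝ) : ℂ) * kirillovFn hτ ℓ v u := by
  refine ⟨v - (((16 * Real.pi ^ 2)⁻¹ : ℝ) : ℂ) •
      gardingEnd hτ (Matrix.single 0 1 ((0, Pi.single w 1) : mixedSpace K))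
        (gardingEnd hτ (Matrix.single 0 1 ((0, Pi.single w 1) : mixedSpace K)) v) -
    (((16 * Real.pi ^ 2)⁻¹ : ℝ) : ℂ) •
      gardingEnd hτ (Matrix.single 0 1 ((0, Pi.single w Complex.I) : mixedSpace K))
        (gardingEnd hτ (Matrix.single 0 1 ((0, Pi.single w Complex.I) : mixedSpace K)) v), fun u => ?_⟩
  rw [kirillovFn_sub_smul, kirillovFn_sub_smul, kirillovFn_gardingEnd_complexIdem hτ hℓW,
    kirillovFn_gardingEnd_complexIdem hτ hℓW, kirillovFn_gardingEnd_complexIdemI hτ hℓW,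
    kirillovFn_gardingEnd_complexIdemI hτ hℓW, Complex.sq_norm, Complex.normSq_apply]
  have hπ : (Real.pi : ℂ) ≠ 0 := by exact_mod_cast Real.pi_ne_zero
  push_cast
  field_simp
  linear_combination (-16) * ((((u : mixedSpace K).2 w).re : ℂ) ^ 2 + ((((u : mixedSpace K).2 w).im : ℂ)) ^ 2) *
    kirillovFn hτ ℓ v u * Complex.I_sq

/-- Kirillov multipliers are closed under products. [folklore] -/
theorem exists_kirillovFn_eq_mul_mul {φ ψ : (mixedSpace K)ˣ → ℂ}
    (hφ : ∀ v : archGardingSpace hcpt τ, ∃ v' : archGardingSpace hcpt τ, ∀ u, kirillovFn hτ ℓ v' u = φ u * kirillovFn hτ ℓ v u)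
    (hψ : ∀ v : archGardingSpace hcpt τ, ∃ v' : archGardingSpace hcpt τ, ∀ u, kirillovFn hτ ℓ v' u = ψ u * kirillovFn hτ ℓ v u)
    (v : archGardingSpace hcpt τ) :
    ∃ v' : archGardingSpace hcpt τ, ∀ u, kirillovFn hτ ℓ v' u = (φ u * ψ u) * kirillovFn hτ ℓ v u := by
  obtain ⟨v₁, hv₁⟩ := hψ v
  obtain ⟨v₂, hv₂⟩ := hφ v₁
  exact ⟨v₂, fun u => by rw [hv₂, hv₁, mul_assoc]⟩

/-- Kirillov multipliers are closed under powers. [folklore] -/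
theorem exists_kirillovFn_eq_pow_mul {φ : (mixedSpace K)ˣ → ℂ}
    (hφ : ∀ v : archGardingSpace hcpt τ, ∃ v' : archGardingSpace hcpt τ, ∀ u, kirillovFn hτ ℓ v' u = φ u * kirillovFn hτ ℓ v u)
    (m : ℕ) (v : archGardingSpace hcpt τ) :
    ∃ v' : archGardingSpace hcpt τ, ∀ u, kirillovFn hτ ℓ v' u = φ u ^ m * kirillovFn hτ ℓ v u := by
  induction m generalizing v with
  | zero => exact ⟨v, fun u => by rw [pow_zero, one_mul]⟩
  | succ m ih =>
    obtain ⟨v₁, hv₁⟩ := ih v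
    obtain ⟨v₂, hv₂⟩ := hφ v₁
    exact ⟨v₂, fun u => by rw [hv₂, hv₁, pow_succ, ← mul_assoc, mul_comm (φ u)]⟩

/-- Kirillov multipliers are closed under finite products. [folklore] -/
theorem exists_kirillovFn_eq_prod_mul {ι : Type*} (s : Finset ι) {φ : ι → (mixedSpace K)ˣ → ℂ}
    (hφ : ∀ i ∈ s, ∀ v : archGardingSpace hcpt τ, ∃ v' : archGardingSpace hcpt τ, ∀ u,
      kirillovFn hτ ℓ v' u = φ i u * kirillovFn hτ ℓ v u)
    (v : archGardingSpace hcpt τ) :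
    ∃ v' : archGardingSpace hcpt τ, ∀ u, kirillovFn hτ ℓ v' u = (∏ i ∈ s, φ i u) * kirillovFn hτ ℓ v u := by
  induction s using Finset.induction_on generalizing v with
  | empty => exact ⟨v, fun u => by rw [Finset.prod_empty, one_mul]⟩
  | @insert j s hj ih =>
    obtain ⟨v₁, hv₁⟩ := ih (fun i hi => hφ i (Finset.mem_insert_of_mem hi)) v
    obtain ⟨v₂, hv₂⟩ := hφ j (Finset.mem_insert_self j s) v₁
    exact ⟨v₂, fun u => by rw [hv₂, hv₁, Finset.prod_insert hj, mul_assoc]⟩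

/-- **The polynomial weights `Φ_m(u) = ∏_{w real} (1 + u_w²)^m ∏_{w complex} (1 + |z_w|²)^m` are Kirillov
multipliers**: for every Gårding `v` there is a Gårding `v'` with `W_{v'} = Φ_m W_v`.
[cite: JacquetLanglands1970, §5 (Lemma 5.13.1), §6] -/
theorem exists_kirillovFn_eq_weight_mul (hℓW : IsArchContWhittakerFunctional hcpt τ hτ ℓ) (m : ℕ)
    (v : archGardingSpace hcpt τ) :
    ∃ v' : archGardingSpace hcpt τ, ∀ u : (mixedSpace K)ˣ,
      kirillovFn hτ ℓ v' u =
        (((∏ w : {w : InfinitePlace K // IsReal w}, (1 + ((u : mixedSpace K).1 w) ^ 2) ^ m) *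
            ∏ w : {w : InfinitePlace K // IsComplex w}, (1 + ‖(u : mixedSpace K).2 w‖ ^ 2) ^ m : ℝ) : ℂ) *
          kirillovFn hτ ℓ v u := by
  have hR : ∀ w ∈ (Finset.univ : Finset {w : InfinitePlace K // IsReal w}), ∀ v : archGardingSpace hcpt τ,
      ∃ v' : archGardingSpace hcpt τ, ∀ u, kirillovFn hτ ℓ v' u =
        (((1 + ((u : mixedSpace K).1 w) ^ 2 : ℝ) : ℂ) ^ m) * kirillovFn hτ ℓ v u := fun w _ =>
    exists_kirillovFn_eq_pow_mul hτ (exists_kirillovFn_eq_one_add_sq_real_mul hτ hℓW w) m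
  have hC : ∀ w ∈ (Finset.univ : Finset {w : InfinitePlace K // IsComplex w}), ∀ v : archGardingSpace hcpt τ,
      ∃ v' : archGardingSpace hcpt τ, ∀ u, kirillovFn hτ ℓ v' u =
        (((1 + ‖(u : mixedSpace K).2 w‖ ^ 2 : ℝ) : ℂ) ^ m) * kirillovFn hτ ℓ v u := fun w _ =>
    exists_kirillovFn_eq_pow_mul hτ (exists_kirillovFn_eq_one_add_normSq_complex_mul hτ hℓW w) m
  obtain ⟨v', hv'⟩ := exists_kirillovFn_eq_mul_mul hτ (exists_kirillovFn_eq_prod_mul hτ Finset.univ hR)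
    (exists_kirillovFn_eq_prod_mul hτ Finset.univ hC) v
  refine ⟨v', fun u => ?_⟩
  rw [hv' u]
  push_cast
  ring

end Multipliers

/-! ### 2. The weight `Φ_m(u)⁻¹ N(u)^{σ-1/2}` is square integrable on `K_∞ˣ` (`1 ≤ σ ≤ m`) -/

section Weight

/-- `((a^m)⁻¹)² = a^{-2m}` for `a > 0`, as a real power. [folklore] -/
theorem inv_pow_sq_eq_rpow {a : ℝ} (ha : 0 < a) (m : ℕ) : ((a ^ m)⁻¹) ^ 2 = a ^ (-(2 * m : ℝ)) := by
  rw [Real.rpow_neg ha.le, show (2 * m : ℝ) = ((2 * m : ℕ) : ℝ) by push_cast; ring, Real.rpow_natCast, pow_mul,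
    ← inv_pow]
  ring

/-- **The real one-variable majorant** `t ↦ (1 + t²)^{-2m} |t|^{2σ-2}` is integrable on `ℝ` for
`1 ≤ σ ≤ m` (Japanese bracket `(1 + t²)^{σ-1-2m}`, Mathlib `integrable_rpow_neg_one_add_norm_sq`). [folklore] -/
theorem integrable_real_weight {σ : ℝ} {m : ℕ} (hσ : 1 ≤ σ) (hm : σ ≤ m) :
    Integrable (fun t : ℝ => ((1 + t ^ 2) ^ m)⁻¹ ^ 2 * |t| ^ (2 * σ - 2)) := by
  have hr : (Module.finrank ℝ ℝ : ℝ) < 4 * m + 2 - 2 * σ := by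
    rw [Module.finrank_self]; push_cast; linarith
  refine (integrable_rpow_neg_one_add_norm_sq hr).mono' ?_ (ae_of_all _ fun t => ?_)
  · refine (Measurable.mul ?_ ?_).aestronglyMeasurable
    · exact ((measurable_const.add (measurable_id.pow_const 2)).pow_const m).inv.pow_const 2
    · exact (measurable_id.abs).pow_const _
  have h1 : 0 < 1 + t ^ 2 := by positivity
  have hpow : |t| ^ (2 * σ - 2) ≤ (1 + t ^ 2) ^ (σ - 1) := by
    rw [show (2 * σ - 2 : ℝ) = 2 * (σ - 1) by ring, Real.rpow_mul (abs_nonneg t),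
      show |t| ^ (2 : ℝ) = t ^ 2 by rw [Real.rpow_two, sq_abs]]
    exact Real.rpow_le_rpow (sq_nonneg t) (by linarith) (by linarith)
  rw [Real.norm_eq_abs, abs_of_nonneg (by positivity), Real.norm_eq_abs, sq_abs,
    show (-(4 * m + 2 - 2 * σ) / 2 : ℝ) = -(2 * m : ℝ) + (σ - 1) by ring, Real.rpow_add h1,
    ← inv_pow_sq_eq_rpow h1]
  exact mul_le_mul_of_nonneg_left hpow (by positivity)

/-- **The complex one-variable majorant** `z ↦ (1 + |z|²)^{-2m} (|z|²)^{2σ-2}` is integrable on `ℂ` for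
`1 ≤ σ ≤ m` (Japanese bracket `(1 + |z|²)^{2σ-2-2m}` in real dimension `2`). [folklore] -/
theorem integrable_complex_weight {σ : ℝ} {m : ℕ} (hσ : 1 ≤ σ) (hm : σ ≤ m) :
    Integrable (fun z : ℂ => ((1 + ‖z‖ ^ 2) ^ m)⁻¹ ^ 2 * (‖z‖ ^ 2) ^ (2 * σ - 2)) := by
  have hr : (Module.finrank ℝ ℂ : ℝ) < 4 * m + 4 - 4 * σ := by
    rw [Complex.finrank_real_complex]; push_cast; linarith
  refine (integrable_rpow_neg_one_add_norm_sq hr).mono' ?_ (ae_of_all _ fun z => ?_)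
  · refine (Measurable.mul ?_ ?_).aestronglyMeasurable
    · exact ((measurable_const.add (measurable_norm.pow_const 2)).pow_const m).inv.pow_const 2
    · exact (measurable_norm.pow_const 2).pow_const _
  have h1 : 0 < 1 + ‖z‖ ^ 2 := by positivity
  have hpow : (‖z‖ ^ 2) ^ (2 * σ - 2) ≤ (1 + ‖z‖ ^ 2) ^ (2 * σ - 2) :=
    Real.rpow_le_rpow (sq_nonneg _) (by linarith) (by linarith)
  rw [Real.norm_eq_abs, abs_of_nonneg (by positivity),
    show (-(4 * m + 4 - 4 * σ) / 2 : ℝ) = -(2 * m : ℝ) + (2 * σ - 2) by ring, Real.rpow_add h1,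
    ← inv_pow_sq_eq_rpow h1]
  exact mul_le_mul_of_nonneg_left hpow (by positivity)

variable (K)

/-- **The weight `Φ_m⁻² N^{2σ-1}` is integrable on `K_∞ˣ`** for every Haar measure and `1 ≤ σ ≤ m`:
`d^×u = c dx/N(x)`, Fubini, and the one-variable majorants (`integrable_and_integral_units_prod_mul_norm_cpow`).
Stated for Mathlib's σ-algebra `comap val` on `K_∞ˣ`. [cite: JacquetLanglands1970, proof of Thm. 11.1, p. 173] -/
theorem integrable_inv_weight_sq_mul_norm_rpow (μ : Measure (mixedSpace K)ˣ) [μ.IsHaarMeasure] {σ : ℝ} {m : ℕ}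
    (hσ : 1 ≤ σ) (hm : σ ≤ m) :
    Integrable (fun u : (mixedSpace K)ˣ =>
      (((∏ w : {w : InfinitePlace K // IsReal w}, (1 + ((u : mixedSpace K).1 w) ^ 2) ^ m) *
          ∏ w : {w : InfinitePlace K // IsComplex w}, (1 + ‖(u : mixedSpace K).2 w‖ ^ 2) ^ m)⁻¹ ^ 2 *
        mixedEmbedding.norm (u : mixedSpace K) ^ (2 * σ - 1))) μ := by
  obtain ⟨c, -, h⟩ := integrable_and_integral_units_prod_mul_norm_cpow K μ
  have hs : ((2 * σ - 1 / 2 : ℝ) : ℂ) - 3 / 2 = ((2 * σ - 2 : ℝ) : ℂ) := by push_cast; ring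
  have hs' : ((2 * σ - 1 / 2 : ℝ) : ℂ) - 1 / 2 = ((2 * σ - 1 : ℝ) : ℂ) := by push_cast; ring
  have hI := (h (fun _ t => ((((1 + t ^ 2) ^ m)⁻¹ ^ 2 : ℝ) : ℂ)) (fun _ z => ((((1 + ‖z‖ ^ 2) ^ m)⁻¹ ^ 2 : ℝ) : ℂ))
    ((2 * σ - 1 / 2 : ℝ) : ℂ) (fun _ => ?_) (fun _ => ?_) (fun _ => ?_) (fun _ => ?_)).1
  rotate_left
  · exact Complex.measurable_ofReal.comp (((measurable_const.add (measurable_id.pow_const 2)).pow_const m).inv.pow_const 2)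
  · exact Complex.measurable_ofReal.comp (((measurable_const.add (measurable_norm.pow_const 2)).pow_const m).inv.pow_const 2)
  · rw [hs]
    refine ((integrable_real_weight hσ hm).ofReal (𝕜 := ℂ)).congr (ae_of_all _ fun t => ?_)
    dsimp only
    rw [← Complex.ofReal_cpow (abs_nonneg t), ← Complex.ofReal_mul]
    rfl
  · rw [hs]
    refine ((integrable_complex_weight hσ hm).ofReal (𝕜 := ℂ)).congr (ae_of_all _ fun z => ?_)
    dsimp only
    rw [← Complex.ofReal_cpow (sq_nonneg _), ← Complex.ofReal_mul]
    rfl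
  rw [hs'] at hI
  refine hI.norm.congr (ae_of_all _ fun u => ?_)
  have hN : 0 ≤ mixedEmbedding.norm (u : mixedSpace K) := mixedEmbedding.norm_nonneg _
  dsimp only
  rw [← Complex.ofReal_cpow hN, norm_mul, Complex.norm_real, Real.norm_of_nonneg (Real.rpow_nonneg hN _), norm_mul,
    ← Complex.ofReal_prod, ← Complex.ofReal_prod, Complex.norm_real, Complex.norm_real,
    Real.norm_of_nonneg (Finset.prod_nonneg fun w _ => by positivity),
    Real.norm_of_nonneg (Finset.prod_nonneg fun w _ => by positivity), mul_inv, mul_pow,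
    ← Finset.prod_inv_distrib, ← Finset.prod_inv_distrib, ← Finset.prod_pow, ← Finset.prod_pow]

end Weight

/-! ### 3. Absolute convergence of the archimedean Hecke integrals (Thm. 5.15 (i), Thm. 6.4 (i)) -/

section Main

variable {hcpt : isCompact_glFiniteIntegralLevel 2 K}
  {E : Type*} [NormedAddCommGroup E] [InnerProductSpace ℂ E] [CompleteSpace E]
  {τ : ContRepresentation ℂ (AutomorphyDatum.gl 2 K hcpt).arch.carrier E}
  {hτ : τ.IsStronglyContinuous} {ℓ : archGardingSpace hcpt τ →ₗ[ℂ] ℂ}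

/-- **Jacquet–Langlands (1970), Thm. 5.15 (i) / Thm. 6.4 (i): the archimedean Hecke integrals converge
absolutely in a right half-plane.** For an irreducible unitary strongly continuous representation `τ` of
`GL₂(K_∞)`, a continuous `ψ_∞`-Whittaker functional `ℓ` on its Gårding space, ANY Gårding vector `v`, any
Borel structure and Haar measure `μ` on `K_∞ˣ` and every `s` with `re s ≥ 1`,
`u ↦ W_v(diag(u,1)) N(u)^{s-1/2}` is `μ`-integrable. (Jacquet–Langlands state absolute convergence in some
right half-plane for the `K`-finite Whittaker functions; the present soft proof — Jacquet–Shalika's `L²`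
bound, polynomial Kirillov multipliers, Cauchy–Schwarz — gives `re s ≥ 1` for all Gårding vectors of a
unitary `τ`.) [cite: JacquetLanglands1970, Thm. 5.15 (i), Thm. 6.4 (i)] [cite: JacquetShalikaAJM1981, §3, (3.16)] -/
theorem integrable_kirillovFn_mul_norm_cpow [inst : MeasurableSpace ((mixedSpace K)ˣ)] [BorelSpace ((mixedSpace K)ˣ)]
    (μ : Measure (mixedSpace K)ˣ) [μ.IsHaarMeasure] (hℓW : IsArchContWhittakerFunctional hcpt τ hτ ℓ)
    (hτu : τ.IsUnitary) (hτi : τ.IsTopIrreducible) (v : archGardingSpace hcpt τ) {s : ℂ} (hs : 1 ≤ s.re) :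
    Integrable (fun u : (mixedSpace K)ˣ => kirillovFn hτ ℓ v u *
      ((mixedEmbedding.norm ((u : (mixedSpace K)ˣ) : mixedSpace K) : ℝ) : ℂ) ^ (s - 1 / 2)) μ := by
  -- reduce to Mathlib's Borel structure `comap val` on `K_∞ˣ` (the Borel facts are invoked as terms)
  have hgeom : HasSummableGeomSeries (mixedSpace K) :=
    Literature.MeasureTheory.Group.hasSummableGeomSeries_of_finiteDimensional
  have hmeas : inst = Units.instMeasurableSpace :=
    (BorelSpace.measurable_eq (α := (mixedSpace K)ˣ)).trans
      (@BorelSpace.measurable_eq (mixedSpace K)ˣ _ Units.instMeasurableSpace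
        (@Literature.MeasureTheory.Group.Units.borelSpace_of_isOpenEmbedding (mixedSpace K) _ hgeom _ _)).symm
  subst hmeas
  obtain ⟨σ, hσ⟩ : ∃ σ : ℝ, σ = s.re := ⟨_, rfl⟩
  obtain ⟨m, hm⟩ : ∃ m : ℕ, m = ⌈σ⌉₊ := ⟨_, rfl⟩
  have hσ1 : 1 ≤ σ := hσ ▸ hs
  have hσm : σ ≤ m := hm ▸ Nat.le_ceil σ
  -- the weight `Φ_m` and the vector `v'` with `W_{v'} = Φ_m W_v`
  obtain ⟨Φ, hΦ⟩ : ∃ Φ : (mixedSpace K)ˣ → ℝ, Φ = fun u : (mixedSpace K)ˣ =>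
      (∏ w : {w : InfinitePlace K // IsReal w}, (1 + ((u : mixedSpace K).1 w) ^ 2) ^ m) *
        ∏ w : {w : InfinitePlace K // IsComplex w}, (1 + ‖(u : mixedSpace K).2 w‖ ^ 2) ^ m := ⟨_, rfl⟩
  have hΦpos : ∀ u, 0 < Φ u := fun u => by
    rw [hΦ]
    exact mul_pos (Finset.prod_pos fun w _ => by positivity) (Finset.prod_pos fun w _ => by positivity)
  obtain ⟨v', hv'⟩ := exists_kirillovFn_eq_weight_mul hτ hℓW m v
  have hv'Φ : ∀ u, kirillovFn hτ ℓ v' u = (Φ u : ℂ) * kirillovFn hτ ℓ v u := fun u => by rw [hv' u, hΦ]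
  -- `W_{v'} ∈ L²` (Jacquet–Shalika) and the weight `Φ⁻¹ N^{σ-1/2} ∈ L²`
  have hL2 : MemLp (kirillovFn hτ ℓ v') 2 μ := memLp_kirillovFn μ hℓW hτu hτi v'
  have hNpos : ∀ u : (mixedSpace K)ˣ, 0 < mixedEmbedding.norm (u : mixedSpace K) := fun u =>
    lt_of_le_of_ne (mixedEmbedding.norm_nonneg _) (norm_ne_zero_of_isUnit K u.isUnit).symm
  obtain ⟨g, hg⟩ : ∃ g : (mixedSpace K)ˣ → ℝ,
      g = fun u : (mixedSpace K)ˣ => (Φ u)⁻¹ * mixedEmbedding.norm (u : mixedSpace K) ^ (σ - 1 / 2) := ⟨_, rfl⟩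
  have hΦc : Continuous Φ := by
    rw [hΦ]
    refine Continuous.mul (continuous_finsetProd _ fun w _ => ?_) (continuous_finsetProd _ fun w _ => ?_)
    · exact (continuous_const.add (((continuous_apply w).comp (continuous_fst.comp Units.continuous_val)).pow 2)).pow m
    · exact (continuous_const.add (((continuous_apply w).comp (continuous_snd.comp Units.continuous_val)).norm.pow 2)).pow m
  have hNc : Continuous fun u : (mixedSpace K)ˣ => mixedEmbedding.norm (u : mixedSpace K) :=
    (mixedEmbedding.continuous_norm K).comp Units.continuous_val
  have hgm : AEStronglyMeasurable g μ := by
    rw [hg]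
    exact ((hΦc.inv₀ fun u => (hΦpos u).ne').mul (hNc.rpow_const fun u => Or.inl (hNpos u).ne')).aestronglyMeasurable
  have hg2 : MemLp g 2 μ := by
    rw [memLp_two_iff_integrable_sq hgm]
    refine (integrable_inv_weight_sq_mul_norm_rpow K μ hσ1 hσm).congr (ae_of_all _ fun u => ?_)
    rw [hg, hΦ]
    simp only [mul_pow]
    rw [← Real.rpow_natCast (mixedEmbedding.norm (u : mixedSpace K) ^ (σ - 1 / 2)) 2, ← Real.rpow_mul (hNpos u).le]
    congr 1
    norm_num
    ring_nf
  have hgC : MemLp (fun u => ((g u : ℝ) : ℂ)) 2 μ := hg2.ofReal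
  have hprod : Integrable (fun u => kirillovFn hτ ℓ v' u * ((g u : ℝ) : ℂ)) μ := hL2.integrable_mul hgC
  -- Cauchy–Schwarz: `|W_v N^{s-1/2}| = |W_{v'}| · g`
  refine hprod.mono ?_ (ae_of_all _ fun u => ?_)
  · refine (Continuous.mul (continuous_kirillovFn hτ hℓW.norm_le v) ?_).aestronglyMeasurable
    refine (Complex.continuous_ofReal.comp ((mixedEmbedding.continuous_norm K).comp Units.continuous_val)).cpow
      continuous_const fun u => Or.inl ?_
    simpa using hNpos u
  · rw [norm_mul, norm_mul, hv'Φ, norm_mul, Complex.norm_real, Complex.norm_real, Real.norm_of_nonneg (hΦpos u).le,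
      hg, Real.norm_of_nonneg (mul_nonneg (inv_nonneg.2 (hΦpos u).le) (Real.rpow_nonneg (hNpos u).le _)),
      Complex.norm_cpow_eq_rpow_re_of_pos (hNpos u), Complex.sub_re, ← hσ]
    norm_num
    rw [mul_comm (Φ u : ℝ), mul_assoc, ← mul_assoc (Φ u : ℝ), mul_inv_cancel₀ (hΦpos u).ne', one_mul]

end Main

end Literature.NumberTheory.Automorphic
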